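import Summits.Ventures.Crystal3D.Theorems.StickyWulffConstantNoReconstructionGainTwoFamilyFilm
import Summits.Ventures.Crystal3D.Theorems.StickyWulffConstantNoReconstructionGainSymmetryOrbit
import HarnessLib

/-!
# The two-family rung on the whole lattice-symmetry orbit: any two `{111}` families

HONEST FRAMING. Part of the venture `Summits/Ventures/Crystal3D` (cell `crystal3d-full`), helper
`--supports` the crux `NoReconstructionGain` (stmt-Ventures-19144, route
`route-Ventures-StickyWulffConstant`), line `adhesion`; continuation of `…TwoFamilyFilm`
(`twoFamilyBarlowFilm_adhesion`: the basal family and the family of the half-turn `R_t` about the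
bond `t`).  Here the pair of families is moved by an arbitrary linear isometry `g` of `ℝ³` mapping
`Λ₀` onto itself (the `48` lattice symmetries act transitively on ordered pairs of distinct `{111}`
families, so every pair is reached):

* `twoFamilyBarlowFilm_adhesion_orbit` (**the rung**, `R = 1`, `C = 0`; registered by name): for
  every unit `ν` with `⟪ν, g e₃⟫² > 1/3` and `⟪ν, g (2√(2/3) t − e₃)⟫² > 1/3` (`2√(2/3) t − e₃ = R_t e₃`
  is the unit axis `(u+v+t)/√6` of the second family), every `ρ ≥ 1`, every finite unit packing
  `X ⊇ P` around the `ν`-slab sample whose film balls lie in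
  `Λ₀ ∪ (Λ₀ ± g w) ∪ (Λ₀ ± g w')` (`w' = (2/3)t − w`) and above the cut:
  `#cross(P, X \ P) ≤ contactDeficiency (X \ P)`.

Proof: pull the configuration back by `g⁻¹` (an isometry preserving `Λ₀`, the slab description with
`ν ↦ g⁻¹ν`, contacts and `contactDeficiency`) and apply `twoFamilyBarlowFilm_adhesion`.

WHAT THIS IS NOT: normals outside the two cones, films below the cut; rung F-C1 not moved.
-/

noncomputable section

namespace Summit.Ventures.Crystal3D.Theorems

open Summit.Ventures.Crystal3D Finset
open Literature.MathematicalPhysics.StatisticalMechanics (barlowPos fccStacking barlowOffset constHagg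
  barlowPos_apply_two orderedContacts contactDeficiency)
open scoped InnerProductSpace

/-- **Two-family Barlow films of the families `g e₃`, `g R_t e₃` at normals inside both cones: the
atom** (`R = 1`, `C = 0`; registered by name on stmt-Ventures-19144). -/
theorem twoFamilyBarlowFilm_adhesion_orbit :
    ∃ R C : ℝ, 1 ≤ R ∧ ∀ ν : EuclideanSpace ℝ (Fin 3), ‖ν‖ = 1 → ∀ ρ : ℝ, R ≤ ρ →
      ∀ X P : Finset (EuclideanSpace ℝ (Fin 3)),
      (∀ p ∈ X, ∀ q ∈ X, p ≠ q → 1 ≤ dist p q) → P ⊆ X →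
      (∀ p, p ∈ P ↔ (p ∈ fccStacking 1 (Real.sqrt (2 / 3)) ∧ -(2 * R) ≤ ⟪p, ν⟫_ℝ ∧
        ⟪p, ν⟫_ℝ ≤ -R ∧ ‖p‖ ^ 2 - ⟪p, ν⟫_ℝ ^ 2 ≤ ρ ^ 2)) →
      ∀ g : EuclideanSpace ℝ (Fin 3) ≃ₗᵢ[ℝ] EuclideanSpace ℝ (Fin 3),
      (∀ p ∈ fccStacking 1 (Real.sqrt (2 / 3)), g p ∈ fccStacking 1 (Real.sqrt (2 / 3))) →
      (∀ p ∈ fccStacking 1 (Real.sqrt (2 / 3)), g.symm p ∈ fccStacking 1 (Real.sqrt (2 / 3))) →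
      1 / 3 < ⟪ν, g (EuclideanSpace.single (2 : Fin 3) (1 : ℝ))⟫_ℝ ^ 2 →
      1 / 3 < ⟪ν, g ((2 * Real.sqrt (2 / 3)) • barlowPos 1 (Real.sqrt (2 / 3)) constHagg 1 0 0 -
        EuclideanSpace.single (2 : Fin 3) (1 : ℝ))⟫_ℝ ^ 2 →
      (∀ q ∈ X \ P, q ∈ fccStacking 1 (Real.sqrt (2 / 3)) ∨
        q - g (barlowOffset 1) ∈ fccStacking 1 (Real.sqrt (2 / 3)) ∨
        q + g (barlowOffset 1) ∈ fccStacking 1 (Real.sqrt (2 / 3)) ∨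
        q - g ((2 / 3 : ℝ) • barlowPos 1 (Real.sqrt (2 / 3)) constHagg 1 0 0 - barlowOffset 1) ∈
          fccStacking 1 (Real.sqrt (2 / 3)) ∨
        q + g ((2 / 3 : ℝ) • barlowPos 1 (Real.sqrt (2 / 3)) constHagg 1 0 0 - barlowOffset 1) ∈
          fccStacking 1 (Real.sqrt (2 / 3))) →
      (∀ q ∈ X \ P, -R < ⟪q, ν⟫_ℝ) →
      ((((P ×ˢ (X \ P)).filter fun pq => dist pq.1 pq.2 = 1).card : ℕ) : ℝ) ≤
        contactDeficiency (X \ P) + C * ρ := by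
  classical
  obtain ⟨R, C, hR, h⟩ := twoFamilyBarlowFilm_adhesion
  refine ⟨R, C, hR, fun ν hν ρ hρ X P hX hPX hP g hg hg' hν3 hν3b hfilm habove => ?_⟩
  -- pull back by `g⁻¹`
  have hgi : Isometry (g.symm : EuclideanSpace ℝ (Fin 3) → EuclideanSpace ℝ (Fin 3)) :=
    g.symm.isometry
  have hinj : Function.Injective (g.symm : EuclideanSpace ℝ (Fin 3) → EuclideanSpace ℝ (Fin 3)) :=
    g.symm.injective
  set X' := X.image g.symm with hX'
  set P' := P.image g.symm with hP'def
  set ν' := g.symm ν with hν'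
  have hsd : X' \ P' = (X \ P).image g.symm := by
    rw [hX', hP'def, image_sdiff_of_injOn hinj.injOn hPX]
  have hXp : ∀ p ∈ X', ∀ q ∈ X', p ≠ q → 1 ≤ dist p q := by
    intro p hp q hq hpq
    obtain ⟨p₀, hp₀, rfl⟩ := mem_image.1 hp
    obtain ⟨q₀, hq₀, rfl⟩ := mem_image.1 hq
    rw [hgi.dist_eq]
    exact hX p₀ hp₀ q₀ hq₀ fun e => hpq (by rw [e])
  have hPXp : P' ⊆ X' := image_subset_image hPX
  have hinn : ∀ p, ⟪g.symm p, ν'⟫_ℝ = ⟪p, ν⟫_ℝ := fun p => by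
    rw [hν', LinearIsometryEquiv.inner_map_map]
  have hνn : ‖ν'‖ = 1 := by rw [hν', LinearIsometryEquiv.norm_map, hν]
  have hPp : ∀ p, p ∈ P' ↔ (p ∈ fccStacking 1 (Real.sqrt (2 / 3)) ∧ -(2 * R) ≤ ⟪p, ν'⟫_ℝ ∧
      ⟪p, ν'⟫_ℝ ≤ -R ∧ ‖p‖ ^ 2 - ⟪p, ν'⟫_ℝ ^ 2 ≤ ρ ^ 2) := by
    intro p
    rw [hP'def, mem_image]
    constructor
    · rintro ⟨p₀, hp₀, rfl⟩
      obtain ⟨hΛ, h1, h2, h3⟩ := (hP p₀).1 hp₀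
      refine ⟨hg' p₀ hΛ, ?_, ?_, ?_⟩
      · rw [hinn]; exact h1
      · rw [hinn]; exact h2
      · rw [hinn, LinearIsometryEquiv.norm_map]; exact h3
    · rintro ⟨hΛ, h1, h2, h3⟩
      have hi : ⟪g p, ν⟫_ℝ = ⟪p, ν'⟫_ℝ := by rw [← hinn (g p), LinearIsometryEquiv.symm_apply_apply]
      refine ⟨g p, (hP (g p)).2 ⟨hg p hΛ, ?_, ?_, ?_⟩, g.symm_apply_apply p⟩
      · rw [hi]; exact h1
      · rw [hi]; exact h2
      · rw [hi, LinearIsometryEquiv.norm_map]; exact h3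
  -- the transported cone conditions
  have hpull : ∀ z : EuclideanSpace ℝ (Fin 3), ⟪ν', z⟫_ℝ = ⟪ν, g z⟫_ℝ := fun z => by
    rw [hν', ← g.inner_map_map, LinearIsometryEquiv.apply_symm_apply]
  have hin3 : ∀ z : EuclideanSpace ℝ (Fin 3), ⟪z, EuclideanSpace.single (2 : Fin 3) (1 : ℝ)⟫_ℝ = z 2 :=
    fun z => by simp [EuclideanSpace.inner_single_right]
  have hν3' : 1 / 3 < ν' 2 ^ 2 := by
    rw [← hin3, hpull]; exact hν3
  have hν3b' : 1 / 3 < (2 * ⟪ν', barlowPos 1 (Real.sqrt (2 / 3)) constHagg 1 0 0⟫_ℝ *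
      Real.sqrt (2 / 3) - ν' 2) ^ 2 := by
    have e : 2 * ⟪ν', barlowPos 1 (Real.sqrt (2 / 3)) constHagg 1 0 0⟫_ℝ * Real.sqrt (2 / 3) - ν' 2 =
        ⟪ν', (2 * Real.sqrt (2 / 3)) • barlowPos 1 (Real.sqrt (2 / 3)) constHagg 1 0 0 -
          EuclideanSpace.single (2 : Fin 3) (1 : ℝ)⟫_ℝ := by
      rw [inner_sub_right, inner_smul_right, hin3]; ring
    rw [e, hpull]; exact hν3b
  -- the transported film classes
  have hfilm' : ∀ q ∈ X' \ P', q ∈ fccStacking 1 (Real.sqrt (2 / 3)) ∨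
      q - barlowOffset 1 ∈ fccStacking 1 (Real.sqrt (2 / 3)) ∨
      q + barlowOffset 1 ∈ fccStacking 1 (Real.sqrt (2 / 3)) ∨
      q - ((2 / 3 : ℝ) • barlowPos 1 (Real.sqrt (2 / 3)) constHagg 1 0 0 - barlowOffset 1) ∈
        fccStacking 1 (Real.sqrt (2 / 3)) ∨
      q + ((2 / 3 : ℝ) • barlowPos 1 (Real.sqrt (2 / 3)) constHagg 1 0 0 - barlowOffset 1) ∈
        fccStacking 1 (Real.sqrt (2 / 3)) := by
    intro q hq
    rw [hsd] at hq
    obtain ⟨q₀, hq₀, rfl⟩ := mem_image.1 hq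
    have hsub : ∀ z : EuclideanSpace ℝ (Fin 3), g.symm q₀ - z = g.symm (q₀ - g z) := fun z => by
      rw [map_sub, LinearIsometryEquiv.symm_apply_apply]
    have hadd : ∀ z : EuclideanSpace ℝ (Fin 3), g.symm q₀ + z = g.symm (q₀ + g z) := fun z => by
      rw [map_add, LinearIsometryEquiv.symm_apply_apply]
    rcases hfilm q₀ hq₀ with h0 | h1 | h2 | h3 | h4
    · exact Or.inl (hg' q₀ h0)
    · exact Or.inr (Or.inl (by rw [hsub]; exact hg' _ h1))
    · exact Or.inr (Or.inr (Or.inl (by rw [hadd]; exact hg' _ h2)))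
    · exact Or.inr (Or.inr (Or.inr (Or.inl (by rw [hsub]; exact hg' _ h3))))
    · exact Or.inr (Or.inr (Or.inr (Or.inr (by rw [hadd]; exact hg' _ h4))))
  have habove' : ∀ q ∈ X' \ P', -R < ⟪q, ν'⟫_ℝ := by
    intro q hq
    rw [hsd] at hq
    obtain ⟨q₀, hq₀, rfl⟩ := mem_image.1 hq
    rw [hinn]; exact habove q₀ hq₀
  have hmain := h ν' hνn ρ hρ X' P' hXp hPXp hPp hν3' hν3b' hfilm' habove'
  rw [hsd, hP'def, card_cross_image_of_isometry hgi, contactDeficiency_image_of_isometry hgi]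
    at hmain
  exact hmain

end Summit.Ventures.Crystal3D.Theorems

end
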